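import Summits.CriticalPhenomena.PercolationContinuityZ3.Theorems.PercNearOneGluingNoHeavyQuantLawDEC
import HarnessLib

/-!
# QUANT lane R8, T-DEC — THE FAR SPLIT: the row `x ≤ P(S ≥ j′+1)` at layer `j′` gives DEC(j′) at that layer (every law, every layer);
# with `LawDec.tail_ge_of_decAt`, DEC(j′) ⟺ the FAR row on the dominant layers `2j′ < T` (DEC-TAMP-G50 §3.3, kernel)

builds on p205010 (kernel theorem, internal audit signed; external expert review pending)

Support file (`--supports stmt-CriticalPhenomena-4575`), QUANT lane typer seat prim-quant-stmt (gen 18), rung R8 of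
`run/shared/lean/prim/quant/LADDER.md`.  Theorems only, no sorries, standard axioms; vocabulary of `…QuantLawDEC` (p257132).

* `Quant.LawDec.sum_Ico_eq_sum_ite` — bookkeeping: `Σ_{h ∈ [j′+1, M]} μ h = Σ_{h ≤ M} [j′+1 ≤ h]·μ h`.
* **`Quant.LawDec.decAt_of_tail_ge`** — for a law `μ` on `{0..M}` (`μ ≥ 0`, vanishing above `M`, mass `1`) and a floor `0 < x ≤ τ := P(S ≥ j′+1)`:
  `DECAt x j′ M μ`.  Construction (DEC-TAMP-G50 §3.3 "FAR split"): if `τ = 1` the law is a mixture of giant point masses (rule (S));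
  otherwise every low atom `lo ≤ j′` rides with every giant `hi ≥ j′+1` in the giant-heavy pair `{lo, hi; τ}` with weight
  `μ lo · μ hi / (τ(1 − τ))` (rule (G), gate `τ ≥ x`) — the product coupling of the conditional laws below and above the layer.
* **`Quant.LawDec.decAt_iff_tail_ge_of_dominant`** — on a dominant layer (`2j′ < T`, `0 < x ≤ 1`): `DECAt x j′ M μ ↔ x ≤ P(S ≥ j′+1)`.
  So the dominant part of `Quant.TreeDEC`-type statements is literally the FAR row (`Quant.FarTreeRow` at layer `j′`), and T-DEC's
  content is the window `T/2 ≤ j′ < top` (census-2 g50).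

[this work]; DEC-TAMP-G50 §3.3 (prim-quant-census-2 g50, this lane).  The gluing rows served [cite: KozmaNitzan2024, Conjecture 3 (p. 15)];
product weights [cite: Grimmett1999, §1.3 p. 10].
-/

noncomputable section

namespace Summit.CriticalPhenomena.PercolationContinuityZ3.Theorems

namespace Quant

open Finset

/-- the two-point law `{lo, hi; g}` (as in `…QuantRootReduction`) -/
local notation3 "TP[" lo ", " hi ", " g ", " h "]" =>
  (g : ℝ) * (if (h : ℕ) = (hi : ℕ) then (1 : ℝ) else 0) + (1 - (g : ℝ)) * (if (h : ℕ) = (lo : ℕ) then (1 : ℝ) else 0)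

namespace LawDec

/-- Bookkeeping: the giant mass as an indicator sum over `{0..M}`. [this work] -/
theorem sum_Ico_eq_sum_ite (M j' : ℕ) (μ : ℕ → ℝ) :
    ∑ h ∈ Finset.Ico (j' + 1) (M + 1), μ h = ∑ h ∈ Finset.range (M + 1), (if j' + 1 ≤ h then μ h else 0) := by
  rw [← Finset.sum_filter]
  congr 1
  ext h
  simp only [Finset.mem_Ico, Finset.mem_filter, Finset.mem_range]
  exact and_comm

/-- **THE FAR SPLIT (DEC-TAMP-G50 §3.3): the row at layer `j′` gives DEC(j′).**  `μ` a law on `{0..M}`, `0 < x ≤ τ = Σ_{h=j′+1}^{M} μ h`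
⟹ `DECAt x j′ M μ`: for `τ = 1` by giant point masses, otherwise by the giant-heavy pairs `{lo, hi; τ}`, `lo ≤ j′ < hi`, with the
product weights `μ lo · μ hi / (τ(1 − τ))`. [this work] -/
theorem decAt_of_tail_ge (M : ℕ) (μ : ℕ → ℝ) (hμ0 : ∀ h, 0 ≤ μ h) (hμM : ∀ h, M < h → μ h = 0)
    (hμ1 : ∑ h ∈ Finset.range (M + 1), μ h = 1) (x : ℝ) (j' : ℕ) (hx0 : 0 < x)
    (hx : x ≤ ∑ h ∈ Finset.Ico (j' + 1) (M + 1), μ h) : DECAt x j' M μ := by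
  classical
  set τ : ℝ := ∑ h ∈ Finset.Ico (j' + 1) (M + 1), μ h with hτ
  have hτι : τ = ∑ h ∈ Finset.range (M + 1), (if j' + 1 ≤ h then μ h else 0) := sum_Ico_eq_sum_ite M j' μ
  have hτ0 : 0 < τ := hx0.trans_le hx
  -- the low/giant split of every atom and of the total mass
  have hsplit : ∀ h, (if h ≤ j' then μ h else 0) + (if j' + 1 ≤ h then μ h else 0) = μ h := by
    intro h
    by_cases hh : h ≤ j'
    · rw [if_pos hh, if_neg (by omega), add_zero]
    · rw [if_neg hh, if_pos (by omega), zero_add]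
  have hlow : ∑ h ∈ Finset.range (M + 1), (if h ≤ j' then μ h else 0) = 1 - τ := by
    have := Finset.sum_congr rfl fun h (_ : h ∈ Finset.range (M + 1)) => hsplit h
    rw [Finset.sum_add_distrib, ← hτι, hμ1] at this
    linarith
  have hA0 : ∀ h, 0 ≤ (if h ≤ j' then μ h else 0) := fun h => by split_ifs; exacts [hμ0 h, le_rfl]
  have hB0 : ∀ h, 0 ≤ (if j' + 1 ≤ h then μ h else 0) := fun h => by split_ifs; exacts [hμ0 h, le_rfl]
  have hτ1 : τ ≤ 1 := by
    have := Finset.sum_nonneg fun h (_ : h ∈ Finset.range (M + 1)) => hA0 h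
    linarith
  -- an atom outside `{0..M}` carries no mass
  have hout : ∀ h, h ∉ Finset.range (M + 1) → μ h = 0 := fun h hh =>
    hμM h (by rw [Finset.mem_range] at hh; omega)
  rcases hτ1.eq_or_lt with hτ1 | hτ1
  · /- `τ = 1`: every charged atom is a giant; point masses (rule (S)). -/
    refine ⟨Fin (M + 1), inferInstance, fun k => μ k, fun _ => 1, fun k => (k : ℕ), fun k => (k : ℕ), fun k => hμ0 k, ?_,
      fun _ => ⟨zero_le_one, le_rfl⟩, fun _ => le_rfl, fun k => Nat.le_of_lt_succ k.isLt, ?_, ?_⟩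
    · exact (Fin.sum_univ_eq_sum_range (fun k => μ k) (M + 1)).trans hμ1
    · intro h
      symm
      refine (Fin.sum_univ_eq_sum_range (fun k => μ k * TP[k, k, (1 : ℝ), h]) (M + 1)).trans ?_
      have hpt : ∀ k, μ k * TP[k, k, (1 : ℝ), h] = if h = k then μ k else 0 := by
        intro k
        by_cases hk : h = k
        · simp only [if_pos hk]; ring
        · simp only [if_neg hk]; ring
      rw [Finset.sum_congr rfl fun k _ => hpt k, Finset.sum_ite_eq]
      by_cases hM : h ∈ Finset.range (M + 1)
      · rw [if_pos hM]
      · rw [if_neg hM, hout h hM]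
    · intro k hk
      dsimp only at hk ⊢
      refine Or.inl ⟨rfl, Or.inr ?_⟩
      by_contra hlt
      have hk' : (k : ℕ) ≤ j' := by omega
      have hle : μ k ≤ ∑ h ∈ Finset.range (M + 1), (if h ≤ j' then μ h else 0) := by
        have := Finset.single_le_sum (f := fun h => if h ≤ j' then μ h else 0) (fun h _ => hA0 h)
          (Finset.mem_range.2 k.isLt)
        simp only [if_pos hk'] at this
        exact this
      linarith
  · /- `τ < 1`: low atoms ride with giants at the common gate `τ` (rule (G)). -/
    have hD : 0 < τ * (1 - τ) := mul_pos hτ0 (by linarith)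
    refine ⟨Fin (M + 1) × Fin (M + 1), inferInstance,
      fun r => if ((r.1 : ℕ) ≤ j' ∧ j' + 1 ≤ (r.2 : ℕ)) then μ r.1 * μ r.2 / (τ * (1 - τ)) else 0,
      fun _ => τ,
      fun r => if ((r.1 : ℕ) ≤ j' ∧ j' + 1 ≤ (r.2 : ℕ)) then (r.1 : ℕ) else 0,
      fun r => if ((r.1 : ℕ) ≤ j' ∧ j' + 1 ≤ (r.2 : ℕ)) then (r.2 : ℕ) else 0,
      ?_, ?_, fun _ => ⟨hτ0.le, hτ1.le⟩, ?_, ?_, ?_, ?_⟩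
    · -- `λ ≥ 0`
      intro r
      dsimp only
      split_ifs
      · exact div_nonneg (mul_nonneg (hμ0 _) (hμ0 _)) hD.le
      · exact le_rfl
    · -- `Σ λ = 1`: `(Σ_low μ)(Σ_giant μ)/(τ(1 − τ)) = 1`
      have hpt : ∀ lo hi : ℕ, (if (lo ≤ j' ∧ j' + 1 ≤ hi) then μ lo * μ hi / (τ * (1 - τ)) else 0) =
          (if lo ≤ j' then μ lo else 0) * (if j' + 1 ≤ hi then μ hi else 0) / (τ * (1 - τ)) := by
        intro lo hi
        by_cases h1 : lo ≤ j' <;> by_cases h2 : j' + 1 ≤ hi <;> simp [h1, h2]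
      refine (sum_finPairs_eq M (fun lo hi => if (lo ≤ j' ∧ j' + 1 ≤ hi) then μ lo * μ hi / (τ * (1 - τ)) else 0)).trans ?_
      simp_rw [hpt, ← Finset.sum_div]
      rw [← Finset.sum_mul_sum, hlow, ← hτι, div_eq_one_iff_eq hD.ne']
      ring
    · -- `lo ≤ hi`
      intro r
      dsimp only
      split_ifs with hg
      · omega
      · exact le_rfl
    · -- `hi ≤ M`
      intro r
      dsimp only
      split_ifs
      · exact Nat.le_of_lt_succ r.2.isLt
      · exact Nat.zero_le _
    · -- the mixture identity
      intro h
      have hpt : ∀ lo hi : ℕ,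
          (if (lo ≤ j' ∧ j' + 1 ≤ hi) then μ lo * μ hi / (τ * (1 - τ)) else 0) *
              TP[(if (lo ≤ j' ∧ j' + 1 ≤ hi) then lo else 0), (if (lo ≤ j' ∧ j' + 1 ≤ hi) then hi else 0), τ, h] =
            τ / (τ * (1 - τ)) * ((if lo ≤ j' then μ lo else 0) * ((if j' + 1 ≤ hi then μ hi else 0) *
                (if h = hi then (1 : ℝ) else 0))) +
              (1 - τ) / (τ * (1 - τ)) * ((if j' + 1 ≤ hi then μ hi else 0) * ((if lo ≤ j' then μ lo else 0) *
                (if h = lo then (1 : ℝ) else 0))) := by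
        intro lo hi
        by_cases h1 : lo ≤ j'
        · by_cases h2 : j' + 1 ≤ hi
          · have hg : lo ≤ j' ∧ j' + 1 ≤ hi := ⟨h1, h2⟩
            simp only [if_pos hg, if_pos h1, if_pos h2]
            ring
          · have hg : ¬ (lo ≤ j' ∧ j' + 1 ≤ hi) := fun hc => h2 hc.2
            simp only [if_neg hg, if_neg h2, zero_mul, mul_zero, add_zero]
        · have hg : ¬ (lo ≤ j' ∧ j' + 1 ≤ hi) := fun hc => h1 hc.1
          simp only [if_neg hg, if_neg h1, zero_mul, mul_zero, add_zero]
      symm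
      refine (sum_finPairs_eq M (fun lo hi =>
          (if (lo ≤ j' ∧ j' + 1 ≤ hi) then μ lo * μ hi / (τ * (1 - τ)) else 0) *
            TP[(if (lo ≤ j' ∧ j' + 1 ≤ hi) then lo else 0), (if (lo ≤ j' ∧ j' + 1 ≤ hi) then hi else 0), τ, h])).trans ?_
      simp_rw [hpt, Finset.sum_add_distrib, ← Finset.mul_sum, ← Finset.sum_mul, ← Finset.mul_sum, Finset.sum_mul_boole, hlow]
      rw [← hτι]
      -- `τ(1−τ)/(τ(1−τ))·[h giant]μ h + (1−τ)τ/(τ(1−τ))·[h low]μ h = μ h`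
      have hc1 : τ / (τ * (1 - τ)) * (1 - τ) = 1 := by field_simp
      have hc2 : (1 - τ) / (τ * (1 - τ)) * τ = 1 := by field_simp
      by_cases hM : h ∈ Finset.range (M + 1)
      · rw [if_pos hM, if_pos hM]
        calc τ / (τ * (1 - τ)) * ((1 - τ) * (if j' + 1 ≤ h then μ h else 0)) +
              (1 - τ) / (τ * (1 - τ)) * (τ * (if h ≤ j' then μ h else 0))
            = (τ / (τ * (1 - τ)) * (1 - τ)) * (if j' + 1 ≤ h then μ h else 0) +
              ((1 - τ) / (τ * (1 - τ)) * τ) * (if h ≤ j' then μ h else 0) := by ring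
          _ = μ h := by rw [hc1, hc2, one_mul, one_mul, add_comm, hsplit h]
      · rw [if_neg hM, if_neg hM, hout h hM]
        ring
    · -- validity: a genuine pair is giant-heavy at gate `τ ≥ x`
      intro r hr
      dsimp only at hr ⊢
      by_cases hg : (r.1 : ℕ) ≤ j' ∧ j' + 1 ≤ (r.2 : ℕ)
      · simp only [if_pos hg]
        exact Or.inr (Or.inl ⟨by omega, hg.2, hx⟩)
      · rw [if_neg hg] at hr
        exact absurd hr (lt_irrefl 0)

/-- **On a dominant layer DEC(j′) IS the FAR row** (DEC-TAMP-G50 §3.3): `μ` a law on `{0..M}` with mean `T`, `2j′ < T`, `0 < x ≤ 1` ⟹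
(`DECAt x j′ M μ ↔ x ≤ Σ_{h=j′+1}^{M} μ h`). [this work] -/
theorem decAt_iff_tail_ge_of_dominant (M : ℕ) (μ : ℕ → ℝ) (hμ0 : ∀ h, 0 ≤ μ h) (hμM : ∀ h, M < h → μ h = 0)
    (hμ1 : ∑ h ∈ Finset.range (M + 1), μ h = 1) (x : ℝ) (j' : ℕ) (hx0 : 0 < x) (hx1 : x ≤ 1)
    (hdom : (2 * j' : ℝ) < ∑ h ∈ Finset.range (M + 1), (h : ℝ) * μ h) :
    DECAt x j' M μ ↔ x ≤ ∑ h ∈ Finset.Ico (j' + 1) (M + 1), μ h :=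
  ⟨fun hdec => tail_ge_of_decAt x j' M μ hx1 hdec hdom, fun hx => decAt_of_tail_ge M μ hμ0 hμM hμ1 x j' hx0 hx⟩

end LawDec

end Quant

end Summit.CriticalPhenomena.PercolationContinuityZ3.Theorems
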